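import Summits.BirchSwinnertonDyer.BirchSwinnertonDyer.Theses.RamifiedHeegnerPair
import Summits.BirchSwinnertonDyer.BirchSwinnertonDyer.Theorems.RamifiedHeegnerPairGss2LowerAtThreeRankOneMcCallumRoad
import HarnessLib

/-!
# Route `RamifiedHeegnerPair` (rev 9) — glue item stmt-BirchSwinnertonDyer-27202 `Gss2LowerAtThreeRankOneGlue`:
# PUB (27199) → A (27200) → NT (27201) → L₁ `Gss2LowerAtThreeRankOne` (26021)

HONEST FRAMING. One theorem closing the GLUE item of the rev-9 split of L₁ (pen pss3 g18, 2026-08-28T09:18Z; children = the registered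
stub texts of line `kolyvagin_split` v3, lead rhp-p1 g4). It books NOTHING about curves: PUB (eleven named published facts), A (the
McCallum-certificate crux = the indivisibility half of the refined Kolyvagin conjecture at an additive `3`, OPEN) and NT (the declared
residual: L₁ on the non-tower rows, OPEN) remain hypotheses; BSD is not proved for any curve. Lead prover bsd-line-rhp-p1 g4.

Proof: on a 3-adic-tower row, p618012 §12 `RamifiedPairLowerBound.gssLowerAtThree_rankOne_towerRows_of_exists_mccallumCertificate` fed with
the eight named facts it consumes (projected out of PUB: Gross–Zagier, Kolyvagin, Kato 14.5(3)+14.16(2), GZK, modularity, Shimura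
reciprocity at conductor 1, Darmon Thm. 3.6, McCallum Cor. 5.6) and A's witness; NT on the other rows. (Equivalently the pen's turnkey
one-liner over p619522 §16.) [cite: McCallumLMS1991, §5 Lemma 5.1 (p. 303) and Cor. 5.6 (p. 310)] [cite: Kato2004Asterisque, Thm. 14.5 (3)
(p. 236)] [cite: JetchevSkinnerWan2017, §7.4.1 (pp. 29–31)] [cite: Miller2011LMS, Def. 1.1]
-/

-- D-0017: single-problem summit, so `Summit.BirchSwinnertonDyer.BirchSwinnertonDyer.…` repeats a namespace BY DESIGN.
set_option linter.dupNamespace false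
set_option autoImplicit false

noncomputable section

open scoped Classical NumberField

namespace Summit.BirchSwinnertonDyer.BirchSwinnertonDyer.Theorems

/-- **Glue 27202 `Gss2LowerAtThreeRankOneGlue` holds**: `Gss2LowerPrintedInputsAtThree → Gss2RankOneMcCallumCertificateAtThreeTower →
Gss2LowerAtThreeRankOneNonTower → Gss2LowerAtThreeRankOne` — the split by the 3-adic image: tower rows by p618012 §12 (McCallum-currency
road: eight named facts ∧ one derived-point certificate per row), non-tower rows by NT. Pure composition; books nothing about curves; BSD is
not proved by this. [cite: McCallumLMS1991, §5 Cor. 5.6 (p. 310)] [cite: Kato2004Asterisque, Thm. 14.5 (3) (p. 236)] [cite: Miller2011LMS, Def. 1.1] -/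
theorem gss2LowerAtThreeRankOneGlue_proof :
    Summit.BirchSwinnertonDyer.BirchSwinnertonDyer.Theses.RamifiedHeegnerPair.Gss2LowerAtThreeRankOneGlue := by
  intro hP hA hN
  obtain ⟨⟨hGZ, hKo, -, hGZK, hmod, -, -, hrec, hMc, h36⟩, hKatoT⟩ := hP
  intro W _ _ hCM hadd hsub hr
  by_cases hρ : ∀ n : ℕ, W.HasSurjectiveModNGaloisRep (3 ^ n : ℕ)
  · exact RamifiedPairLowerBound.gssLowerAtThree_rankOne_towerRows_of_exists_mccallumCertificate hGZ hKo hKatoT hGZK hmod hrec h36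
      hMc hA W hadd hsub hr hρ
  · exact hN W hCM hadd hsub hr hρ

end Summit.BirchSwinnertonDyer.BirchSwinnertonDyer.Theorems

end
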